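import Mathlib
import Literature.NumberTheory.DiophantineGeometry.AbcWave0

/-!
# Stub `stub_coreBound` (S3) of line `SketchIdeator5R2` — crux `IneffectiveSubspace.DeepRegimeABC`
# (stmt-ABC-15121): `RidoutCoreBound` from Ridout's theorem with integer targets

WHAT. The *core mass* of an abc triple `(a, b, c)` on the places `{p ≤ y} ∪ {∞}` is
`M_y(a,b,c) = Σ_{p ≤ y, p ∣ abc} v_p(abc)·log p + log (c / min(a,b))`. Assuming Ridout's `p`-adic
Roth theorem over `ℚ` in the form `hR` (archimedean target `0` with a partial share, INTEGER
`p`-adic targets `k_p`, rationals `|ρ| ≤ 1`, exponent `κ > 2` ⟹ finitely many `ρ`), the CORED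
triples `M_y(a,b,c) ≥ (2+δ)·log c` are bounded (`ridoutCoreBound_of_ridoutZeroInt`).

PROOF (Bombieri–Gubler, Thm. 6.2.3 with 6.2.5: a Möbius transformation making all targets finite).
Order the triple as `m = min(a,b)`, `M = max(a,b)`, put `t = y!` and `ρ = (1+t)m/(m+tc) ∈ (0,1]`,
the image of `β = m/c` under `x ↦ (1+t)x/(x+t)`, which sends the rational targets `0, 1, ∞` of `β`
(at the primes dividing `m`, `M`, `c`) to the integers `0, 1, 1+t`. For a prime `p ≤ y` (`p ∣ t`):
`min(1,|ρ|_p) ≤ p^{v_p(t)}·p^{-v_p(m)}` if `p ∣ m`, `|ρ − 1|_p ≤ p^{-v_p(M)}` if `p ∣ M`,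
`|ρ − (1+t)|_p ≤ p^{-v_p(c)}` otherwise; and `|ρ| ≤ 2m/c`. Hence, with `T = Π_{p ≤ y} p^{v_p(t)}`,
`|ρ|·Π_{p ≤ y} min(1,|ρ − k_p|_p) ≤ 2T·e^{-M_y(a,b,c)} ≤ 2T·c^{-(2+δ)} ≤ den(ρ)^{-(2+δ/2)}` once
`den ρ ≤ m + tc ≤ (1+t)c` exceeds an explicit `D₀(t, δ)`. So `ρ` lies in the union of the finitely
many exceptional sets of `hR` (one per target pattern `k`, indexed by pairs of subsets of the primes
`≤ y`) and the finite set `{|ρ| ≤ 1, den ρ ≤ D₀}`; and `c` is recovered from `ρ` as the numerator of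
`((1+t)/ρ − 1)/t = c/m`.

Deliberately NOT here: Ridout's theorem itself (hypothesis `hR`; stubs `stub_ridoutClassFalse`,
`stub_ridoutRat` of the line), the coreless tail, and the composition to `DeepRegimeABC`.
-/

-- `Summit.ABC.ABC…` is the mandated summit-side namespace; the duplicate component is deliberate.
set_option linter.dupNamespace false

namespace Summit.ABC.ABC.Theorems.DeepRegimeABC

open Literature.NumberTheory.DiophantineGeometry

/-- If `p^f ∣ n` then `|n|_p ≤ p^{-f}`. [folklore] -/
theorem padicNorm_natCast_le_of_pow_dvd {p n f : ℕ} [Fact p.Prime] (h : p ^ f ∣ n) :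
    padicNorm p (n : ℚ) ≤ ((p : ℚ) ^ f)⁻¹ := by
  have := (padicNorm.dvd_iff_norm_le (p := p) (n := f) (z := (n : ℤ))).1 (by exact_mod_cast h)
  simpa [zpow_natCast] using this

/-- If `p^{e+1} ∤ n ≠ 0` then `p^{-e} ≤ |n|_p`. [folklore] -/
theorem inv_pow_le_padicNorm_natCast {p n e : ℕ} [hp : Fact p.Prime] (hn : n ≠ 0)
    (h : ¬ p ^ (e + 1) ∣ n) : ((p : ℚ) ^ e)⁻¹ ≤ padicNorm p (n : ℚ) := by
  have hv : padicValNat p n ≤ e := by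
    by_contra hlt
    exact h ((padicValNat_dvd_iff_le hn).2 (by omega))
  rw [padicNorm.eq_zpow_of_nonzero (by exact_mod_cast hn), padicValRat.of_nat, ← zpow_natCast,
    ← zpow_neg]
  exact zpow_le_zpow_right₀ (by exact_mod_cast hp.out.one_lt.le) (by omega)

/-- `|−x/D|_p ≤ p^{-f}` when `p ∤ D` and `p^f ∣ x`. [folklore] -/
theorem padicNorm_neg_div_le {p x D f : ℕ} [Fact p.Prime] (hD : ¬ p ∣ D) (hx : p ^ f ∣ x) :
    padicNorm p (-(x : ℚ) / (D : ℚ)) ≤ ((p : ℚ) ^ f)⁻¹ := by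
  rw [padicNorm.div, padicNorm.neg, (padicNorm.nat_eq_one_iff D).2 hD, div_one]
  exact padicNorm_natCast_le_of_pow_dvd hx

/-- Case `p ∣ a` (so `p ∤ c`): `min(1, |ρ|_p) ≤ p^{v_p(t)}·p^{-v_p(a)}` for `ρ = (1+t)a/(a+tc)`; if
`v_p(a) > v_p(t)` then `v_p(a + tc) = v_p(t)` exactly. [cite: BombieriGubler2006, Thm. 6.2.3 with 6.2.5] -/
theorem min_padicNorm_rho_le {p t a c : ℕ} [hp : Fact p.Prime] (ht : 0 < t) (ha : 0 < a) (hc : 0 < c)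
    (hpc : ¬ p ∣ c) {ρ : ℚ} (hρ : ρ = (((1 + t) * a : ℕ) : ℚ) / ((a + t * c : ℕ) : ℚ)) :
    min (1 : ℚ) (padicNorm p ρ) ≤
      (p : ℚ) ^ (t.factorization p) * ((p : ℚ) ^ (a.factorization p))⁻¹ := by
  subst hρ
  have hp1 : (1 : ℚ) ≤ p := by exact_mod_cast hp.out.one_lt.le
  have hp0 : (0 : ℚ) < p := by exact_mod_cast hp.out.pos
  rcases le_or_gt (a.factorization p) (t.factorization p) with hfe | hef
  · calc min (1 : ℚ) _ ≤ 1 := min_le_left _ _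
      _ ≤ (p : ℚ) ^ (t.factorization p) * ((p : ℚ) ^ (a.factorization p))⁻¹ := by
        rw [← div_eq_mul_inv, one_le_div (pow_pos hp0 _)]
        exact pow_le_pow_right₀ hp1 hfe
  · have h_a : p ^ (t.factorization p + 1) ∣ a :=
      (pow_dvd_pow p (Nat.succ_le_of_lt hef)).trans (Nat.ordProj_dvd a p)
    have h_tc : ¬ p ^ (t.factorization p + 1) ∣ t * c := by
      have hf : (t * c).factorization p = t.factorization p := by
        rw [Nat.factorization_mul ht.ne' hc.ne', Finsupp.add_apply,
          Nat.factorization_eq_zero_of_not_dvd hpc, add_zero]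
      rw [← hf]
      exact Nat.pow_succ_factorization_not_dvd (mul_ne_zero ht.ne' hc.ne') hp.out
    have hD : ¬ p ^ (t.factorization p + 1) ∣ a + t * c := fun h =>
      h_tc ((Nat.dvd_add_right h_a).1 h)
    calc min (1 : ℚ) _ ≤ padicNorm p ((((1 + t) * a : ℕ) : ℚ) / ((a + t * c : ℕ) : ℚ)) :=
          min_le_right _ _
      _ = padicNorm p (((1 + t) * a : ℕ) : ℚ) / padicNorm p ((a + t * c : ℕ) : ℚ) :=
          padicNorm.div _ _
      _ ≤ ((p : ℚ) ^ (a.factorization p))⁻¹ / ((p : ℚ) ^ (t.factorization p))⁻¹ :=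
          div_le_div₀ (by positivity)
            (padicNorm_natCast_le_of_pow_dvd (dvd_mul_of_dvd_right (Nat.ordProj_dvd a p) _))
            (by positivity) (inv_pow_le_padicNorm_natCast (Nat.add_pos_left ha _).ne' hD)
      _ = _ := by rw [div_inv_eq_mul, mul_comm]

/-- The local factor at a prime `p ∣ t` for the target pattern `k_p = 0, 1, 1+t` according as
`p ∣ a`, `p ∣ b`, otherwise: `min(1, |ρ − k_p|_p) ≤ p^{v_p(t)}·p^{-v_p(abc)}` (in `ℝ`). For `p ∤ a` one
has `p ∤ a + tc`, `ρ − 1 = −tb/(a+tc)` and `ρ − (1+t) = −(1+t)tc/(a+tc)`.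
[cite: BombieriGubler2006, Thm. 6.2.3 with 6.2.5] -/
theorem min_padicNorm_rho_sub_le {p t a b c : ℕ} (hp : p.Prime) (hpt : p ∣ t) (ht : 0 < t)
    (ha : 0 < a) (hb : 0 < b) (habc : a + b = c) (hcop : a.Coprime b) {ρ : ℚ}
    (hρ : ρ = (((1 + t) * a : ℕ) : ℚ) / ((a + t * c : ℕ) : ℚ)) {k : ℤ}
    (hk0 : p ∣ a → k = 0) (hk1 : ¬ p ∣ a → p ∣ b → k = 1) (hk2 : ¬ p ∣ a → ¬ p ∣ b → k = 1 + t) :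
    min (1 : ℝ) ((padicNorm p (ρ - k) : ℚ) : ℝ) ≤
      (p : ℝ) ^ (t.factorization p) * ((p : ℝ) ^ ((a * b * c).factorization p))⁻¹ := by
  haveI := Fact.mk hp
  have hc : 0 < c := habc ▸ Nat.add_pos_left ha b
  have hfac : (a * b * c).factorization p =
      a.factorization p + b.factorization p + c.factorization p := by
    rw [Nat.factorization_mul (mul_ne_zero ha.ne' hb.ne') hc.ne', Nat.factorization_mul ha.ne' hb.ne']
    rfl
  have hp1 : (1 : ℚ) ≤ p := by exact_mod_cast hp.one_lt.le
  suffices h : min (1 : ℚ) (padicNorm p (ρ - k)) ≤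
      (p : ℚ) ^ (t.factorization p) * ((p : ℚ) ^ ((a * b * c).factorization p))⁻¹ by
    have h' := (Rat.cast_le (K := ℝ)).2 h; push_cast at h'; exact h'
  by_cases hpa : p ∣ a
  · have hpb : ¬ p ∣ b := (Nat.Prime.coprime_iff_not_dvd hp).1 (hcop.coprime_dvd_left hpa)
    have hpc : ¬ p ∣ c := fun h => hpb ((Nat.dvd_add_right hpa).1 (by rwa [habc]))
    rw [hk0 hpa, Int.cast_zero, sub_zero, hfac, Nat.factorization_eq_zero_of_not_dvd hpb,
      Nat.factorization_eq_zero_of_not_dvd hpc, add_zero, add_zero]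
    exact min_padicNorm_rho_le ht ha hc hpc hρ
  -- `p ∤ a`: the denominator `a + tc` is a `p`-adic unit
  have hD : ¬ p ∣ a + t * c := fun h => hpa ((Nat.dvd_add_left (dvd_mul_of_dvd_left hpt c)).1 h)
  have hD0 : ((a + t * c : ℕ) : ℚ) ≠ 0 := by exact_mod_cast (Nat.add_pos_left ha _).ne'
  refine (min_le_right _ _).trans ?_
  by_cases hpb : p ∣ b
  · have hpc : ¬ p ∣ c := fun h => hpa ((Nat.dvd_add_left hpb).1 (by rwa [habc]))
    have hid : ρ - 1 = -((t * b : ℕ) : ℚ) / ((a + t * c : ℕ) : ℚ) := by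
      rw [hρ, div_sub_one hD0]; congr 1; subst habc; push_cast; ring
    rw [hk1 hpa hpb, Int.cast_one, hfac, Nat.factorization_eq_zero_of_not_dvd hpa,
      Nat.factorization_eq_zero_of_not_dvd hpc, zero_add, add_zero, hid]
    exact (padicNorm_neg_div_le hD (dvd_mul_of_dvd_right (Nat.ordProj_dvd b p) _)).trans
      (le_mul_of_one_le_left (by positivity) (one_le_pow₀ hp1))
  · have hid : ρ - (1 + t) = -(((1 + t) * t * c : ℕ) : ℚ) / ((a + t * c : ℕ) : ℚ) := by
      rw [hρ, eq_div_iff hD0]; field_simp; push_cast; ring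
    rw [hk2 hpa hpb, hfac, Nat.factorization_eq_zero_of_not_dvd hpa,
      Nat.factorization_eq_zero_of_not_dvd hpb, zero_add, zero_add]
    push_cast
    rw [hid]
    exact (padicNorm_neg_div_le hD (dvd_mul_of_dvd_right (Nat.ordProj_dvd c p) _)).trans
      (le_mul_of_one_le_left (by positivity) (one_le_pow₀ hp1))

/-- `0 ≤ ρ ≤ 1` and `ρ ≤ 2a/c` for `ρ = (1+t)a/(a+tc)`, `t ≥ 1`, `a ≤ c`. [folklore] -/
theorem rho_real_bounds {t a c : ℕ} (ht : 0 < t) (ha : 0 < a) (hac : a ≤ c) {ρ : ℚ}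
    (hρ : ρ = (((1 + t) * a : ℕ) : ℚ) / ((a + t * c : ℕ) : ℚ)) :
    0 ≤ (ρ : ℝ) ∧ (ρ : ℝ) ≤ 1 ∧ (ρ : ℝ) ≤ 2 * a / c := by
  have hc : 0 < c := lt_of_lt_of_le ha hac
  have hρR : (ρ : ℝ) = ((1 + t) * a : ℝ) / (a + t * c : ℝ) := by rw [hρ]; push_cast; ring
  have hta : (0 : ℝ) < a := by exact_mod_cast ha
  have htc : (0 : ℝ) < c := by exact_mod_cast hc
  have ht1 : (1 : ℝ) ≤ t := by exact_mod_cast ht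
  have hac' : (a : ℝ) ≤ c := by exact_mod_cast hac
  have hD : (0 : ℝ) < a + t * c := by positivity
  rw [hρR]
  refine ⟨by positivity, ?_, ?_⟩
  · rw [div_le_one hD]
    nlinarith [mul_le_mul_of_nonneg_left hac' (by positivity : (0 : ℝ) ≤ t)]
  · rw [div_le_div_iff₀ hD htc]
    nlinarith [mul_nonneg (mul_nonneg hta.le htc.le) (sub_nonneg.2 ht1), mul_pos hta hta]

/-- The denominator of `N/D` (naturals, `D > 0`) is at most `D`. [folklore] -/
theorem den_natCast_div_le (N : ℕ) {D : ℕ} (hD : 0 < D) : ((N : ℚ) / (D : ℚ)).den ≤ D := by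
  have h := Rat.den_dvd (N : ℤ) (D : ℤ)
  rw [← Rat.intCast_div_eq_divInt, Int.cast_natCast, Int.cast_natCast] at h
  exact Nat.le_of_dvd hD (by exact_mod_cast h)

/-- Recovering `c` from `ρ = (1+t)a/(a+tc)`: `((1+t)/ρ − 1)/t = c/a`, whose numerator is `c`
since `gcd(c, a) = gcd(a + b, a) = 1`. [folklore] -/
theorem natAbs_num_recover {t a b c : ℕ} (ht : 0 < t) (ha : 0 < a) (habc : a + b = c)
    (hcop : a.Coprime b) {ρ : ℚ} (hρ : ρ = (((1 + t) * a : ℕ) : ℚ) / ((a + t * c : ℕ) : ℚ)) :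
    ((((1 + t : ℚ) / ρ) - 1) / t).num.natAbs = c := by
  have hq : (((1 + t : ℚ) / ρ) - 1) / t = ((c : ℤ) : ℚ) / ((a : ℤ) : ℚ) := by
    rw [hρ]
    have h1 : ((a + t * c : ℕ) : ℚ) ≠ 0 := by exact_mod_cast (Nat.add_pos_left ha _).ne'
    have h2 : (((1 + t) * a : ℕ) : ℚ) ≠ 0 := by
      exact_mod_cast (Nat.mul_pos (Nat.add_pos_left Nat.one_pos t) ha).ne'
    have h3 : (a : ℚ) ≠ 0 := by exact_mod_cast ha.ne'
    have h4 : (t : ℚ) ≠ 0 := by exact_mod_cast ht.ne'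
    have h5 : (1 + t : ℚ) ≠ 0 := by positivity
    push_cast at h1 h2 ⊢; field_simp; ring
  have hca : Nat.Coprime c a := by rw [← habc]; exact Nat.coprime_self_add_left.2 hcop.symm
  rw [hq, Rat.num_div_eq_of_coprime (by exact_mod_cast ha) (by simpa using hca), Int.natAbs_natCast]

/-- Rationals with `|ρ| ≤ 1` and denominator `≤ D` form a finite set (`|num ρ| ≤ den ρ ≤ D`).
[folklore] -/
theorem finite_abs_le_one_den_le (D : ℕ) : {ρ : ℚ | |(ρ : ℝ)| ≤ 1 ∧ ρ.den ≤ D}.Finite := by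
  -- adapted from `Ridout.exists_den_gt` (Literature/NumberTheory/DiophantineApproximation/RidoutClasses)
  have hsub : {ρ : ℚ | |(ρ : ℝ)| ≤ 1 ∧ ρ.den ≤ D} ⊆ (fun ρ : ℚ => (ρ.num, ρ.den)) ⁻¹'
      ((Finset.Icc (-(D : ℤ)) D ×ˢ Finset.Icc 0 D : Finset (ℤ × ℕ)) : Set (ℤ × ℕ)) := by
    rintro ρ ⟨h1, h2⟩
    have h1' : |ρ| ≤ 1 := by exact_mod_cast h1
    have hnum : |ρ.num| ≤ (ρ.den : ℤ) := by
      have h : |(ρ.num : ℚ)| ≤ (ρ.den : ℚ) := by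
        rw [← Rat.mul_den_eq_num, abs_mul, Nat.abs_cast]
        exact mul_le_of_le_one_left (by positivity) h1'
      exact_mod_cast h
    have hD : |ρ.num| ≤ (D : ℤ) := hnum.trans (by exact_mod_cast h2)
    simp only [Set.mem_preimage, Finset.coe_product, Finset.coe_Icc, Set.mem_prod, Set.mem_Icc]
    exact ⟨abs_le.1 hD, Nat.zero_le _, h2⟩
  refine Set.Finite.subset (Set.Finite.preimage ?_ (Finset.finite_toSet _)) hsub
  intro ρ _ ρ' _ h
  simp only [Prod.mk.injEq] at h
  exact Rat.ext h.1 h.2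

/-- The core estimate: for an abc triple `(a, b, c)` (no ordering needed), `t ≥ 1` divisible by every
prime of `P = {p ≤ y prime}`, `ρ = (1+t)a/(a+tc)` and the target pattern `k_p ∈ {0, 1, 1+t}`
(`p ∣ a`, `p ∣ b`, otherwise), one has
`|ρ|·Π_{p∈P} min(1, |ρ − k_p|_p) ≤ 2·(Π_{p∈P} p^{v_p t})·exp(−(Σ_{p≤y, p∣abc} v_p(abc) log p + log(c/a)))`.
[cite: BombieriGubler2006, Thm. 6.2.3 with 6.2.5] -/
theorem core_estimate {y t : ℕ} {P : Finset ℕ} (hPmem : ∀ p, p ∈ P ↔ p.Prime ∧ p ≤ y)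
    (ht : 0 < t) (hPt : ∀ p ∈ P, p ∣ t)
    {a b c : ℕ} (ha : 0 < a) (hb : 0 < b) (habc : a + b = c) (hcop : a.Coprime b)
    {ρ : ℚ} (hρ : ρ = (((1 + t) * a : ℕ) : ℚ) / ((a + t * c : ℕ) : ℚ))
    {k : ℕ → ℤ} (hk0 : ∀ p ∈ P, p ∣ a → k p = 0) (hk1 : ∀ p ∈ P, ¬ p ∣ a → p ∣ b → k p = 1)
    (hk2 : ∀ p ∈ P, ¬ p ∣ a → ¬ p ∣ b → k p = 1 + t) :
    |(ρ : ℝ)| * ∏ p ∈ P, min (1 : ℝ) ((padicNorm p (ρ - k p) : ℚ) : ℝ) ≤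
      2 * (∏ p ∈ P, (p : ℝ) ^ (t.factorization p)) *
        Real.exp (-((∑ p ∈ (a * b * c).primeFactors.filter (fun p => p ≤ y),
            ((a * b * c).factorization p : ℝ) * Real.log p) + Real.log ((c : ℝ) / (a : ℝ)))) := by
  have hc : 0 < c := habc ▸ Nat.add_pos_left ha b
  have hN0 : a * b * c ≠ 0 := mul_ne_zero (mul_ne_zero ha.ne' hb.ne') hc.ne'
  -- Step 1: the product over `P`, prime by prime
  have hprod : ∏ p ∈ P, min (1 : ℝ) ((padicNorm p (ρ - k p) : ℚ) : ℝ) ≤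
      (∏ p ∈ P, (p : ℝ) ^ (t.factorization p)) *
        ∏ p ∈ P, ((p : ℝ) ^ ((a * b * c).factorization p))⁻¹ := by
    rw [← Finset.prod_mul_distrib]
    refine Finset.prod_le_prod (fun p _ => le_min zero_le_one (by exact_mod_cast padicNorm.nonneg _))
      fun p hp => ?_
    exact min_padicNorm_rho_sub_le ((hPmem p).1 hp).1 (hPt p hp) ht ha hb habc hcop hρ (hk0 p hp)
      (hk1 p hp) (hk2 p hp)
  -- Step 2: the second product is `exp(−Σ)`
  have hsub : (a * b * c).primeFactors.filter (fun p => p ≤ y) ⊆ P := fun p hp => by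
    rw [Finset.mem_filter] at hp
    exact (hPmem p).2 ⟨Nat.prime_of_mem_primeFactors hp.1, hp.2⟩
  have hexp : Real.exp (-(∑ p ∈ (a * b * c).primeFactors.filter (fun p => p ≤ y),
      ((a * b * c).factorization p : ℝ) * Real.log p)) =
        ∏ p ∈ P, ((p : ℝ) ^ ((a * b * c).factorization p))⁻¹ := by
    rw [← Finset.sum_neg_distrib, Real.exp_sum]
    have h1 : ∏ p ∈ (a * b * c).primeFactors.filter (fun p => p ≤ y),
        Real.exp (-(((a * b * c).factorization p : ℝ) * Real.log p)) =
        ∏ p ∈ (a * b * c).primeFactors.filter (fun p => p ≤ y),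
          ((p : ℝ) ^ ((a * b * c).factorization p))⁻¹ := by
      refine Finset.prod_congr rfl fun p hp => ?_
      have hp0 : (0 : ℝ) < p := by
        exact_mod_cast (Nat.prime_of_mem_primeFactors (Finset.mem_filter.1 hp).1).pos
      rw [Real.exp_neg, mul_comm, ← Real.rpow_def_of_pos hp0, Real.rpow_natCast]
    rw [h1]
    refine Finset.prod_subset hsub fun p hpP hpS => ?_
    have hv : (a * b * c).factorization p = 0 :=
      Nat.factorization_eq_zero_of_not_dvd fun hdvd => hpS (Finset.mem_filter.2
        ⟨Nat.mem_primeFactors.2 ⟨((hPmem p).1 hpP).1, hdvd, hN0⟩, ((hPmem p).1 hpP).2⟩)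
    rw [hv, pow_zero, inv_one]
  -- Step 3: the archimedean factor `|ρ| ≤ 2a/c` and `exp(−log(c/a)) = a/c`
  obtain ⟨hρ0, -, hρ2⟩ := rho_real_bounds ht ha (habc ▸ Nat.le_add_right a b) hρ
  have hP0 : 0 ≤ ∏ p ∈ P, min (1 : ℝ) ((padicNorm p (ρ - k p) : ℚ) : ℝ) :=
    Finset.prod_nonneg fun p _ => le_min zero_le_one (by exact_mod_cast padicNorm.nonneg _)
  have hca : (0 : ℝ) < (c : ℝ) / (a : ℝ) := div_pos (by exact_mod_cast hc) (by exact_mod_cast ha)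
  rw [abs_of_nonneg hρ0]
  calc (ρ : ℝ) * ∏ p ∈ P, min (1 : ℝ) ((padicNorm p (ρ - k p) : ℚ) : ℝ)
      ≤ (2 * a / c) * ((∏ p ∈ P, (p : ℝ) ^ (t.factorization p)) *
          Real.exp (-(∑ p ∈ (a * b * c).primeFactors.filter (fun p => p ≤ y),
            ((a * b * c).factorization p : ℝ) * Real.log p))) :=
        mul_le_mul hρ2 (hexp ▸ hprod) hP0 (by positivity)
    _ = _ := by
        rw [neg_add, Real.exp_add, Real.exp_neg (Real.log ((c : ℝ) / (a : ℝ))), Real.exp_log hca,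
          inv_div]
        ring

/-- The final bookkeeping, all in logarithms: from `(2+δ)·lc ≤ K`, `log d ≤ lt + lc` and
`2((2+δ)·lt + log(2T)) < δ·log d` one gets `2T·e^{−K} ≤ d^{−(2+δ/2)}`. [folklore] -/
theorem final_bookkeeping {T K δ lc lt d : ℝ} (hT : 0 < T) (hd : 0 < d)
    (hcore : (2 + δ) * lc ≤ K) (hlogden : Real.log d ≤ lt + lc)
    (hL : 2 * ((2 + δ) * lt + Real.log (2 * T)) < Real.log d * δ) (hδ : 0 ≤ 2 + δ) :
    2 * T * Real.exp (-K) ≤ d ^ (-(2 + δ / 2)) := by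
  rw [Real.rpow_def_of_pos hd, show 2 * T * Real.exp (-K) = Real.exp (Real.log (2 * T) - K) by
    rw [Real.exp_sub, Real.exp_log (by positivity), Real.exp_neg, div_eq_mul_inv]]
  refine Real.exp_le_exp.2 ?_
  have h3 := mul_le_mul_of_nonneg_left hlogden hδ
  linarith

/-- **S3 — `RidoutCoreBound` from Ridout's theorem with integer targets.** Assuming Ridout's theorem
over `ℚ` in the form `hR` (archimedean target `0` with partial share, integer `p`-adic targets,
`|ρ| ≤ 1`, exponent `κ > 2` ⟹ finiteness), for every `y` and `δ > 0` the abc triples with core mass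
`Σ_{p ≤ y, p ∣ abc} v_p(abc) log p + log(c / min(a,b)) ≥ (2+δ) log c` have bounded `c`. Proof: Möbius
transformation `ρ = (1+t)m/(m+tc)`, `t = y!`, `m = min(a,b)`, one application of `hR` per target
pattern with `κ = 2 + δ/2`, plus the finitely many `ρ` of small denominator; `c` is read off `ρ` as
the numerator of `((1+t)/ρ − 1)/t = c/m`. [cite: BombieriGubler2006, Thm. 6.2.3 with 6.2.5] -/
theorem ridoutCoreBound_of_ridoutZeroInt
    (hR : ∀ (S : Finset ℕ), (∀ p ∈ S, p.Prime) → ∀ (k : ℕ → ℤ) (κ : ℝ), 2 < κ →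
      {ρ : ℚ | |(ρ : ℝ)| ≤ 1 ∧
        |(ρ : ℝ)| * (∏ p ∈ S, min (1 : ℝ) ((padicNorm p (ρ - k p) : ℚ) : ℝ)) ≤
          (ρ.den : ℝ) ^ (-κ)}.Finite) :
    ∀ y : ℕ, ∀ δ : ℝ, 0 < δ → ∃ B : ℝ, ∀ a b c : ℕ, IsABCTriple a b c →
      (2 + δ) * Real.log c ≤
        (∑ p ∈ (a * b * c).primeFactors.filter (fun p => p ≤ y),
            ((a * b * c).factorization p : ℝ) * Real.log p)
          + Real.log ((c : ℝ) / ((min a b : ℕ) : ℝ)) →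
      (c : ℝ) ≤ B := by
  intro y δ hδ
  -- `t = y!`: positive and divisible by every prime `p ≤ y`
  obtain ⟨t, ht, htdvd⟩ : ∃ t : ℕ, 0 < t ∧ ∀ p : ℕ, p.Prime → p ≤ y → p ∣ t :=
    ⟨y.factorial, Nat.factorial_pos y, fun p hp hpy => Nat.dvd_factorial hp.pos hpy⟩
  -- the primes `≤ y`
  set P : Finset ℕ := (Finset.range (y + 1)).filter Nat.Prime with hPdef
  have hPmem : ∀ p, p ∈ P ↔ p.Prime ∧ p ≤ y := fun p => by
    rw [hPdef, Finset.mem_filter, Finset.mem_range]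
    exact ⟨fun h => ⟨h.2, Nat.lt_succ_iff.1 h.1⟩, fun h => ⟨Nat.lt_succ_iff.2 h.2, h.1⟩⟩
  have hP : ∀ p ∈ P, p.Prime := fun p hp => ((hPmem p).1 hp).1
  have hPt : ∀ p ∈ P, p ∣ t := fun p hp => htdvd p ((hPmem p).1 hp).1 ((hPmem p).1 hp).2
  have hκ : (2 : ℝ) < 2 + δ / 2 := by linarith
  -- the finitely many target patterns, indexed by pairs of subsets of `P`
  obtain ⟨kOf, hkOf⟩ : ∃ kOf : Finset ℕ × Finset ℕ → ℕ → ℤ,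
      ∀ τ p, kOf τ p = if p ∈ τ.1 then 0 else if p ∈ τ.2 then 1 else 1 + (t : ℤ) :=
    ⟨fun τ p => if p ∈ τ.1 then 0 else if p ∈ τ.2 then 1 else 1 + (t : ℤ), fun _ _ => rfl⟩
  -- constants
  set T : ℝ := ∏ p ∈ P, (p : ℝ) ^ (t.factorization p) with hTdef
  have hT : 0 < T := Finset.prod_pos fun p hp => pow_pos (by exact_mod_cast (hP p hp).pos) _
  set L : ℝ := (2 + δ) * Real.log (1 + t) + Real.log (2 * T) with hLdef
  set D₀ : ℕ := ⌈Real.exp (2 * L / δ)⌉₊ with hD₀def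
  -- the finite exceptional set: Ridout's exceptions for each pattern, plus small denominators
  set E : Set ℚ := (⋃ τ ∈ (↑(P.powerset ×ˢ P.powerset) : Set (Finset ℕ × Finset ℕ)),
      {ρ : ℚ | |(ρ : ℝ)| ≤ 1 ∧
        |(ρ : ℝ)| * (∏ p ∈ P, min (1 : ℝ) ((padicNorm p (ρ - kOf τ p) : ℚ) : ℝ)) ≤
          (ρ.den : ℝ) ^ (-(2 + δ / 2))}) ∪ {ρ : ℚ | |(ρ : ℝ)| ≤ 1 ∧ ρ.den ≤ D₀} with hEdef
  have hEfin : E.Finite :=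
    (Set.Finite.biUnion (Finset.finite_toSet _) fun τ _ => hR P hP (kOf τ) _ hκ).union
      (finite_abs_le_one_den_le D₀)
  -- recovering `c` from `ρ`
  obtain ⟨G, hG⟩ : ∃ G : ℚ → ℕ, ∀ ρ, G ρ = ((((1 + t : ℚ) / ρ) - 1) / t).num.natAbs :=
    ⟨_, fun _ => rfl⟩
  obtain ⟨B₀, hB₀⟩ := (hEfin.image G).bddAbove
  refine ⟨B₀, fun a b c habc hcore => ?_⟩
  obtain ⟨ha, hb, hsum, hcopab⟩ := habc
  -- order the triple: `m = min(a,b)`, `M = max(a,b)`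
  obtain ⟨m, M, hm, hM, hmM, hcop, hmin, hprod⟩ : ∃ m M : ℕ, 0 < m ∧ 0 < M ∧ m + M = c ∧
      m.Coprime M ∧ min a b = m ∧ a * b * c = m * M * c := by
    rcases le_total a b with h | h
    · exact ⟨a, b, ha, hb, hsum, hcopab, min_eq_left h, rfl⟩
    · exact ⟨b, a, hb, ha, (add_comm b a).trans hsum, hcopab.symm, min_eq_right h,
        by rw [mul_comm a b]⟩
  rw [hmin, hprod] at hcore
  have hc : 0 < c := hmM ▸ Nat.add_pos_left hm M
  have hmc : m ≤ c := hmM ▸ Nat.le_add_right m M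
  -- the rational `ρ`
  set ρ : ℚ := (((1 + t) * m : ℕ) : ℚ) / ((m + t * c : ℕ) : ℚ) with hρ
  have hGρ : G ρ = c := by rw [hG]; exact natAbs_num_recover ht hm hmM hcop hρ
  obtain ⟨hρ0, hρ1, -⟩ := rho_real_bounds ht hm hmc hρ
  have habs : |(ρ : ℝ)| ≤ 1 := by rwa [abs_of_nonneg hρ0]
  -- it suffices that `ρ ∈ E`
  suffices hmem : ρ ∈ E by exact_mod_cast mem_upperBounds.1 hB₀ c ⟨ρ, hmem, hGρ⟩
  by_cases hden : ρ.den ≤ D₀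
  · exact Set.mem_union_right _ ⟨habs, hden⟩
  refine Set.mem_union_left _ (Set.mem_biUnion (x := (P.filter (· ∣ m), P.filter (· ∣ M)))
    (Finset.mem_coe.2 (Finset.mem_product.2 ⟨Finset.mem_powerset.2 (Finset.filter_subset _ _),
      Finset.mem_powerset.2 (Finset.filter_subset _ _)⟩)) ⟨habs, ?_⟩)
  -- the main estimate, for the pattern of this triple
  push Not at hden
  have hk0 : ∀ p ∈ P, p ∣ m → kOf (P.filter (· ∣ m), P.filter (· ∣ M)) p = 0 :=
    fun p hp hpm => by simp [hkOf, Finset.mem_filter, hp, hpm]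
  have hk1 : ∀ p ∈ P, ¬ p ∣ m → p ∣ M → kOf (P.filter (· ∣ m), P.filter (· ∣ M)) p = 1 :=
    fun p hp hpm hpM => by simp [hkOf, Finset.mem_filter, hp, hpm, hpM]
  have hk2 : ∀ p ∈ P, ¬ p ∣ m → ¬ p ∣ M → kOf (P.filter (· ∣ m), P.filter (· ∣ M)) p = 1 + t :=
    fun p hp hpm hpM => by simp [hkOf, Finset.mem_filter, hpm, hpM]
  have hest := core_estimate hPmem ht hPt hm hM hmM hcop hρ hk0 hk1 hk2
  -- denominators: `den ρ ≤ m + tc ≤ (1+t)c`, and `den ρ > D₀`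
  have hdenle : ρ.den ≤ (1 + t) * c :=
    calc ρ.den ≤ m + t * c := den_natCast_div_le _ (Nat.add_pos_left hm _)
      _ ≤ c + t * c := Nat.add_le_add_right hmc _
      _ = (1 + t) * c := by ring
  have hden0 : (0 : ℝ) < ρ.den := by exact_mod_cast ρ.den_pos
  have hlogden : Real.log ρ.den ≤ Real.log (1 + t) + Real.log c := by
    rw [← Real.log_mul (by positivity) (by exact_mod_cast hc.ne')]
    exact Real.log_le_log hden0 (by exact_mod_cast hdenle)
  have hLlt : 2 * L < Real.log ρ.den * δ := by
    rw [← div_lt_iff₀ hδ, Real.lt_log_iff_exp_lt hden0]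
    calc Real.exp (2 * L / δ) ≤ D₀ := Nat.le_ceil _
      _ < ρ.den := by exact_mod_cast hden
  exact hest.trans (final_bookkeeping hT hden0 hcore hlogden hLlt (by linarith))

/-- The registered stub `stub_coreBound` of the line, verbatim: `RidoutZeroInt → RidoutCoreBound`
(unfolded); it is `ridoutCoreBound_of_ridoutZeroInt`. [cite: BombieriGubler2006, Thm. 6.2.3 with 6.2.5] -/
theorem stub_coreBound
    (hR : ∀ (S : Finset ℕ), (∀ p ∈ S, p.Prime) → ∀ (k : ℕ → ℤ) (κ : ℝ), 2 < κ →
      {ρ : ℚ | |(ρ : ℝ)| ≤ 1 ∧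
        |(ρ : ℝ)| * (∏ p ∈ S, min (1 : ℝ) ((padicNorm p (ρ - k p) : ℚ) : ℝ)) ≤
          (ρ.den : ℝ) ^ (-κ)}.Finite) :
    ∀ y : ℕ, ∀ δ : ℝ, 0 < δ → ∃ B : ℝ, ∀ a b c : ℕ, IsABCTriple a b c →
      (2 + δ) * Real.log c ≤
        (∑ p ∈ (a * b * c).primeFactors.filter (fun p => p ≤ y),
            ((a * b * c).factorization p : ℝ) * Real.log p)
          + Real.log ((c : ℝ) / ((min a b : ℕ) : ℝ)) →
      (c : ℝ) ≤ B :=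
  ridoutCoreBound_of_ridoutZeroInt hR

end Summit.ABC.ABC.Theorems.DeepRegimeABC
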